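import Mathlib.Analysis.Fourier.FiniteAbelian.PontryaginDuality
import Mathlib.LinearAlgebra.Matrix.SpecialLinearGroup
import Literature.RepresentationTheory.FiniteGroups.CliffordCorrespondence
import Literature.RepresentationTheory.FiniteGroups.TaketaTheorem
import Literature.LinearAlgebra.Matrix.ProjectiveSpecialLinearGroupSimple
import Literature.LinearAlgebra.Matrix.MirabolicOrbit
import HarnessLib

/-!
# The minimal degree of a non-linear irreducible character of `SL_n(𝔽_q)`
# (Landazuri–Seitz 1974, Lemma 3.1)

Topic `Literature/RepresentationTheory/FiniteGroups`, namespace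
`Literature.RepresentationTheory.FiniteGroups` (grouping sub-namespace `SLn` for the auxiliary
objects attached to the group `SL_n`).  Everything here is **proved**; no named fact.

Source, verbatim.  V. Landazuri, G. M. Seitz, *On the minimal degrees of projective representations
of the finite Chevalley groups*, J. Algebra 32 (1974) 418–443 [LandazuriSeitz1974], held copy
`paper:doi-10-1016-0021-8693-74-90150-1`, p. 424 (PDF p. 7):

> "LEMMA 3.1. Let `G = PSL(n, q)` and assume `m_p(G) = 1`. If `n = 2`, then
> `l(G, p) ≥ (1/d)(q − 1)`, where `d = (2, q − 1)`. If `n > 2`, then `l(G, p) ≥ q^{n−1} − 1`.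
> *Proof.* `G` permutes the 1-dimensional subspaces of an `n`-dimensional vector space `V` over
> `𝔽_q`. Let `P` be the stabilizer of a fixed 1-space of `V`. Then `P` is a parabolic subgroup of
> `G`. There is a normal elementary subgroup `Q` of `P` with `|Q| = q^{n−1}`. Suppose `n > 2`. Then
> `P` contains a subgroup `RH₀`, where `R ≅ SL(n − 1, q)`, `H₀` is cyclic of order `q − 1`,
> `[R, H₀] = 1`, and `RH₀` acts faithfully on `Q`, with `H₀` inducing scalar multiplication. Also
> `RH₀` is transitive on `Q^#`. If `n = 2`, then `P` is Frobenius of order `(1/d) q(q − 1)`,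
> `d = (2, q − 1)`. Now suppose `M` is a representation module of a projective irreducible
> representation of `G` … Clearly `Q₀` is not contained in the kernel of `Ĝ` on `M`. So there is
> some `Q₀`-submodule `M₀` of `M` such that `M₀` affords a nontrivial 1-dimensional representation
> of `Q₀`. Suppose `n > 2`. As `RH₀` is transitive on `Q^#`, the preimage of `RH₀` in `Ĝ` is
> transitive on `Q₀^#` and hence transitive on the nontrivial irreducible representations of `Q₀`
> (see [2], Lemma 1). Thus `dim(M) ≥ q^{n−1} − 1`. If `n = 2`, the preimage of `P` has 1 or 2
> nontrivial orbits on `Q₀^#`, of length `(1/d)(q − 1)`, `d = (2, q − 1)`. Hence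
> `dim(M) ≥ (1/d)(q − 1)`."

Here `l(G, p)` is the least degree `> 1` of a projective irreducible representation of
`G = PSL(n, q)` in characteristic `≠ p`.  This file proves the lemma for the ORDINARY (complex)
irreducible characters of the group `SL_n(𝔽_q)` itself — which are projective representations of
`PSL(n, q) = SL(n, q)/Z` realised linearly on the central extension `SL(n, q)` — i.e. the instance
of Lemma 3.1 that is quoted as "`n(SL(n,q)) ≥ Ω(q^{n−1})`" in the matrix-multiplication barrier of
Blasiak–Cohn–Grochow–Pratt–Umans 2023, Cor. 3.4 (`Literature/Barriers/MatrixMultiplication/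
QuasirandomBarrierLieType.lean`), with no exception and no Schur-multiplier hypothesis (none is
needed for linear characters of `SL_n(𝔽_q)`):

* **`SLn.le_charDegree_of_three_le`** — for `n ≥ 3` and every finite field `F` with `q` elements,
  every character degree `d > 1` of `SL_n(F)` satisfies `q^{n−1} − 1 ≤ d`;
* **`SLn.le_charDegree_two`** — for `n = 2`: `q − 1 ≤ gcd(2, q − 1) · d`, i.e.
  `d ≥ (1/d₂)(q − 1)` with `d₂ = (2, q − 1)` as printed; and the coarser `q ≤ 2d + 1`
  (`SLn.card_le_two_mul_charDegree_add_one`) valid for every `n ≥ 2`.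

## The proof (as printed, in the language of the tree)

Write `n = m + 1` and let `e = e_last` be the last standard basis vector of `F^{m+1}` (the tree's
`Literature.LinearAlgebra.Matrix.lastVec`, file `MirabolicOrbit`).
* `Q`: the **root group** `SLn.rootSubgroup` = the image of the injective homomorphism
  `SLn.rootHom : (F^m, +) → SL_{m+1}(F)`, `u ↦ x(u) = 1 + e ⊗ (u, 0)` (the matrix that is the
  identity except for its last row `(u₀, …, u_{m−1}, 1)`); it is the elementary abelian group of
  order `q^m = q^{n−1}` of the source (the unipotent radical of the stabiliser of the hyperplane
  `x_last = 0`/of the line through `e` in the dual numbering).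
* `P`: its normaliser `Subgroup.normalizer SLn.rootSubgroup`; every `g ∈ SL_{m+1}(F)` with `g e = a e`
  normalises `Q` (`SLn.mem_normalizer_of_mulVec_eq`), with the explicit conjugation formula
  `g x(u) g⁻¹ = x(a · (u,0) g⁻¹)` (`SLn.conj_rootHom`).
* The characters of `Q ≅ F^m` are `u ↦ ψ(u · y)`, `y ∈ F^m`, for a fixed non-trivial additive
  character `ψ` of `F` (Mathlib's finite Fourier duality `AddChar.card_eq`,
  `AddChar.exists_apply_ne_zero`; `SLn.exists_eq_dotChar`), and conjugation by such a `g` acts on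
  the parameter by `y ↦ a · init(g⁻¹ (y, 0))` (`SLn.conj_param`).
* For `m ≥ 2` the block-diagonal copy `SLn.blockDiag : SL_m(F) → SL_{m+1}(F)` of
  `R = SL(n−1, q)` is transitive on the non-zero parameters (`SLn.exists_mulVec_eq`, from the
  tree's `exists_lastRow_eq` of `MirabolicOrbit`), so every non-trivial character of `Q` has
  `q^m − 1` conjugates under `P`; for `m = 1` the torus `diag(a⁻¹, a)` acts by `y ↦ a² y`, giving
  `#(F^×)² = (q − 1)/(2, q − 1)` conjugates.
* Clifford (Isaacs Thm. 6.2 / Lemma 6.8, the tree's `apply_one_eq_mul_of_classInner_restrict_ne_zero`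
  and Cor. 6.7 `apply_coe_eq_apply_one_of_classInner_restrict_one_ne_zero`, applied to `Q ⊴ P`):
  an irreducible constituent `θ` of `χ_P` on which `Q` acts non-trivially has degree
  `e · t · 1 ≥ t = ` the number of conjugates.  "`Q₀` is not contained in the kernel": otherwise
  `ker χ ⊴ SL_n(F)` is a normal subgroup containing the non-central `Q`, hence all of `SL_n(F)`
  (the tree's `SLn.normal_le_center_or_eq_top`, Artin Thm. 4.9: `n ≥ 3`, or `n = 2` and
  `|F| ≥ 4`), so `χ` is the trivial character and `χ(1) = 1`.  For `n = 2`, `|F| ≤ 3` the bound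
  `(q − 1)/(2, q − 1) ≤ 1 < d` is empty of content and holds trivially.

## Mathlib / tree search

Mathlib: `Matrix.SpecialLinearGroup` (+ `center`, `mem_center_iff`, `transvection`), `AddChar`
with `AddChar.card_eq` / `AddChar.exists_apply_ne_zero` (finite abelian duality),
`Representation.IsIrreducible.finrank_eq_one_of_isMulCommutative`; no minimal degrees of finite
groups of Lie type (`lean search 'Landazuri|minimal degree|quasirandom'`: docstrings only).  Tree,
consumed by name: `IsIrrChar`, `irrChars`, `charDegrees`, `IsCharacter(.restrict)`, `classInner`,
`IsClassFun.eq_sum_classInner_smul`, `clifford_restrict_eq` & `apply_one_eq_mul_of_classInner_restrict_ne_zero`,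
`apply_coe_eq_apply_one_of_classInner_restrict_one_ne_zero`, `IsCharacter.exists_isIrrChar_classInner_ne_zero`,
`IsCharacter.exists_eq_add_of_classInner_ne_zero`, `Representation.mem_ker_iff_character_eq`,
`IsIrrChar.sum_normSq_eq_card`, `SLn.normal_le_center_or_eq_top`, `MirabolicOrbit.exists_lastRow_eq`.

## References

* [LandazuriSeitz1974] V. Landazuri, G. M. Seitz, *On the minimal degrees of projective
  representations of the finite Chevalley groups*, J. Algebra 32 (1974) 418–443, Lemma 3.1 (p. 424).
* [Isaacs1976] I. M. Isaacs, *Character Theory of Finite Groups*, Thm. 6.2, Cor. 6.7, Lemma 6.8.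
* [BlasiakCohnGrochowPrattUmans2023] Cor. 3.4 (the consumer).
-/

noncomputable section

open scoped BigOperators
open Matrix

namespace Literature.RepresentationTheory.FiniteGroups

namespace SLn

open Literature.LinearAlgebra.Matrix (lastVec lastVec_ne_zero exists_lastRow_eq lastRow_apply)

variable {F : Type} [Field F] {m : ℕ}

/-! ## §1 The root group `Q = {x(u) = 1 + e ⊗ (u, 0)}` -/

section RootGroup

/-- Small bookkeeping: `(u, 0) + (u', 0) = (u + u', 0)` for `Fin.snoc`. [folklore] -/
private theorem snoc_zero_add (u u' : Fin m → F) :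
    (Fin.snoc (u + u') 0 : Fin (m + 1) → F) = Fin.snoc u 0 + Fin.snoc u' 0 := by
  ext i
  refine Fin.lastCases ?_ (fun j => ?_) i
  · simp [Fin.snoc_last]
  · simp [Fin.snoc_castSucc]

/-- `(a • u, 0) = a • (u, 0)`. [folklore] -/
private theorem snoc_zero_smul (a : F) (u : Fin m → F) :
    (Fin.snoc (a • u) 0 : Fin (m + 1) → F) = a • Fin.snoc u 0 := by
  ext i
  refine Fin.lastCases ?_ (fun j => ?_) i
  · simp [Fin.snoc_last]
  · simp [Fin.snoc_castSucc]

/-- `(u, 0) · v = u · init v`. [folklore] -/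
private theorem snoc_zero_dotProduct (u : Fin m → F) (v : Fin (m + 1) → F) :
    Fin.snoc u 0 ⬝ᵥ v = u ⬝ᵥ Fin.init v := by
  simp [dotProduct, Fin.sum_univ_castSucc, Fin.snoc_castSucc, Fin.snoc_last, Fin.init]

/-- `v · (y, 0) = init v · y`. [folklore] -/
private theorem dotProduct_snoc_zero (v : Fin (m + 1) → F) (y : Fin m → F) :
    v ⬝ᵥ Fin.snoc y 0 = Fin.init v ⬝ᵥ y := by
  simp [dotProduct, Fin.sum_univ_castSucc, Fin.snoc_castSucc, Fin.snoc_last, Fin.init]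

/-- A vector with last coordinate `0` is `(init w, 0)`. [folklore] -/
private theorem snoc_init_of_last_eq_zero {w : Fin (m + 1) → F} (hw : w (Fin.last m) = 0) :
    Fin.snoc (Fin.init w) 0 = w := by
  conv_rhs => rw [← Fin.snoc_init_self w]
  rw [hw]

/-- The last standard basis vector `e = e_last ∈ F^{m+1}` is the tree's
`Literature.LinearAlgebra.Matrix.lastVec m F = Pi.single (Fin.last m) 1` (`MirabolicOrbit`).
[folklore] -/
private theorem lastVec_apply_last : lastVec m F (Fin.last m) = 1 := by
  simp [lastVec]

/-- `w · e = w_last`. [folklore] -/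
private theorem dotProduct_lastVec (w : Fin (m + 1) → F) : w ⬝ᵥ lastVec m F = w (Fin.last m) := by
  simp [lastVec]

/-- The root matrix `x(u) = 1 + e ⊗ (u, 0)`: the identity matrix with last row replaced by
`(u₀, …, u_{m−1}, 1)`; it maps `v ↦ v + ((u,0) · v) e`.
[cite: LandazuriSeitz1974, Lemma 3.1 (proof: "a normal elementary subgroup `Q` of `P` with `|Q| = q^{n-1}`")] -/
def rootMatrix (u : Fin m → F) : Matrix (Fin (m + 1)) (Fin (m + 1)) F :=
  1 + vecMulVec (lastVec m F) (Fin.snoc u 0)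

/-- `det (1 + a ⊗ b) = 1 + b · a` (matrix determinant lemma). [folklore] -/
private theorem det_one_add_vecMulVec (a b : Fin (m + 1) → F) :
    (1 + vecMulVec a b).det = 1 + b ⬝ᵥ a := by
  rw [vecMulVec_eq (ι := Unit), det_one_add_replicateCol_mul_replicateRow]

/-- `det x(u) = 1`. [cite: LandazuriSeitz1974, Lemma 3.1] -/
theorem det_rootMatrix (u : Fin m → F) : (rootMatrix u).det = 1 := by
  rw [rootMatrix, det_one_add_vecMulVec, dotProduct_lastVec, Fin.snoc_last, add_zero]

/-- `x(u) x(u') = x(u + u')`. [cite: LandazuriSeitz1974, Lemma 3.1] -/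
theorem rootMatrix_add (u u' : Fin m → F) :
    rootMatrix (u + u') = rootMatrix u * rootMatrix u' := by
  rw [rootMatrix, rootMatrix, rootMatrix, snoc_zero_add, vecMulVec_add]
  simp only [Matrix.add_mul, Matrix.mul_add, Matrix.one_mul, Matrix.mul_one,
    vecMulVec_mul_vecMulVec, dotProduct_lastVec, Fin.snoc_last, zero_smul, vecMulVec_zero, add_zero]
  abel

/-- `x(0) = 1`. [folklore] -/
private theorem rootMatrix_zero : rootMatrix (0 : Fin m → F) = 1 := by
  have h : (Fin.snoc (0 : Fin m → F) 0 : Fin (m + 1) → F) = 0 := by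
    ext i; refine Fin.lastCases ?_ (fun j => ?_) i <;> simp [Fin.snoc_last, Fin.snoc_castSucc]
  rw [rootMatrix, h, vecMulVec_zero, add_zero]

/-- The entries of the last row of `x(u)` off the diagonal are the coordinates of `u`. [folklore] -/
private theorem rootMatrix_last_castSucc (u : Fin m → F) (j : Fin m) :
    rootMatrix u (Fin.last m) (Fin.castSucc j) = u j := by
  simp [rootMatrix, vecMulVec_apply, lastVec, Fin.snoc_castSucc,
    Matrix.one_apply_ne (Fin.castSucc_lt_last j).ne']

/-- **The root homomorphism** `(F^m, +) → SL_{m+1}(F)`, `u ↦ x(u)`.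
[cite: LandazuriSeitz1974, Lemma 3.1] -/
def rootHom : Multiplicative (Fin m → F) →* SpecialLinearGroup (Fin (m + 1)) F where
  toFun u := ⟨rootMatrix u.toAdd, det_rootMatrix _⟩
  map_one' := Subtype.ext (by simp [rootMatrix_zero])
  map_mul' u u' := Subtype.ext (by simp [rootMatrix_add])

/-- The matrix of `rootHom u` is `x(u)`. [folklore] -/
private theorem coe_rootHom (u : Fin m → F) :
    ((rootHom (Multiplicative.ofAdd u) : SpecialLinearGroup (Fin (m + 1)) F) :
      Matrix (Fin (m + 1)) (Fin (m + 1)) F) = rootMatrix u := rfl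

/-- `u ↦ x(u)` is injective (`|Q| = q^{n-1}`). [cite: LandazuriSeitz1974, Lemma 3.1] -/
theorem rootHom_injective : Function.Injective (rootHom (F := F) (m := m)) := by
  intro u u' h
  have h' := congrArg (fun g : SpecialLinearGroup (Fin (m + 1)) F =>
    (g : Matrix (Fin (m + 1)) (Fin (m + 1)) F)) h
  change rootMatrix u.toAdd = rootMatrix u'.toAdd at h'
  refine Multiplicative.toAdd.injective (funext fun j => ?_)
  rw [← rootMatrix_last_castSucc u.toAdd j, ← rootMatrix_last_castSucc u'.toAdd j, h']

variable (m F) in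
/-- **The root group `Q`** (the elementary abelian normal subgroup of order `q^{n−1}` of the
parabolic `P`): the image of `rootHom`. [cite: LandazuriSeitz1974, Lemma 3.1] -/
def rootSubgroup : Subgroup (SpecialLinearGroup (Fin (m + 1)) F) := (rootHom (F := F) (m := m)).range

/-- `x(u) ∈ Q`. [folklore] -/
private theorem rootHom_mem (u : Multiplicative (Fin m → F)) : rootHom u ∈ rootSubgroup F m := ⟨u, rfl⟩

/-- Membership in `Q`. [folklore] -/
private theorem mem_rootSubgroup_iff {g : SpecialLinearGroup (Fin (m + 1)) F} :
    g ∈ rootSubgroup F m ↔ ∃ u : Fin m → F, rootHom (Multiplicative.ofAdd u) = g :=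
  ⟨fun ⟨u, hu⟩ => ⟨u.toAdd, hu⟩, fun ⟨u, hu⟩ => ⟨Multiplicative.ofAdd u, hu⟩⟩

/-- `Q` is not central: `x(u)` is a scalar matrix only for `u = 0` (needs `m ≥ 1`). [folklore] -/
private theorem rootHom_not_mem_center {u : Fin m → F} (hu : u ≠ 0) :
    rootHom (Multiplicative.ofAdd u) ∉ Subgroup.center (SpecialLinearGroup (Fin (m + 1)) F) := by
  intro h
  obtain ⟨r, -, hr⟩ := Matrix.SpecialLinearGroup.mem_center_iff.mp h
  obtain ⟨j, hj⟩ : ∃ j, u j ≠ 0 := by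
    by_contra h0
    push Not at h0
    exact hu (funext h0)
  have h1 := congrArg (fun M : Matrix (Fin (m + 1)) (Fin (m + 1)) F => M (Fin.last m) (Fin.castSucc j)) hr
  simp only [coe_rootHom, rootMatrix_last_castSucc] at h1
  rw [Matrix.scalar_apply, Matrix.diagonal_apply_ne _ (Fin.castSucc_lt_last j).ne'] at h1
  exact hj h1.symm

end RootGroup

/-! ## §2 Conjugation by the stabiliser of the line `F e` -/

section Conjugation

/-- If `g e = a e` for an invertible `g` (here: `g g' = 1 = g' g`), then `a ≠ 0` and
`g' e = a⁻¹ e`. [folklore] -/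
private theorem inv_mulVec_lastVec {M M' : Matrix (Fin (m + 1)) (Fin (m + 1)) F} (hMM' : M' * M = 1)
    {a : F} (hM : M *ᵥ lastVec m F = a • lastVec m F) :
    a ≠ 0 ∧ M' *ᵥ lastVec m F = a⁻¹ • lastVec m F := by
  have h1 : M' *ᵥ (M *ᵥ lastVec m F) = lastVec m F := by
    rw [mulVec_mulVec, hMM', one_mulVec]
  rw [hM, mulVec_smul] at h1
  have ha : a ≠ 0 := by
    rintro rfl
    rw [zero_smul] at h1
    exact lastVec_ne_zero m F h1.symm
  refine ⟨ha, ?_⟩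
  calc M' *ᵥ lastVec m F = a⁻¹ • (a • M' *ᵥ lastVec m F) := by
        rw [smul_smul, inv_mul_cancel₀ ha, one_smul]
    _ = a⁻¹ • lastVec m F := by rw [h1]

/-- The parameter of the conjugate root element: `c_g(u) = a · init((u, 0) g⁻¹)`.
[cite: LandazuriSeitz1974, Lemma 3.1 (proof: "`RH₀` acts faithfully on `Q`")] -/
def conjVec (M' : Matrix (Fin (m + 1)) (Fin (m + 1)) F) (a : F) (u : Fin m → F) : Fin m → F :=
  a • Fin.init (Fin.snoc u 0 ᵥ* M')

/-- **Conjugation formula** `g x(u) g⁻¹ = x(a · (u,0) g⁻¹)` for `g e = a e` (matrices `M = g`,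
`M' = g⁻¹`). [cite: LandazuriSeitz1974, Lemma 3.1] -/
theorem conj_rootMatrix {M M' : Matrix (Fin (m + 1)) (Fin (m + 1)) F} (hMM' : M * M' = 1)
    (hM'M : M' * M = 1) {a : F} (hM : M *ᵥ lastVec m F = a • lastVec m F) (u : Fin m → F) :
    M * rootMatrix u * M' = rootMatrix (conjVec M' a u) := by
  obtain ⟨ha, hM'⟩ := inv_mulVec_lastVec hM'M hM
  -- the last coordinate of `(u,0) g⁻¹` vanishes
  have hlast : (Fin.snoc u 0 ᵥ* M') (Fin.last m) = 0 := by
    have : (Fin.snoc u 0 ᵥ* M') ⬝ᵥ lastVec m F = 0 := by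
      rw [← dotProduct_mulVec, hM', dotProduct_smul, dotProduct_lastVec, Fin.snoc_last, smul_zero]
    rwa [dotProduct_lastVec] at this
  rw [rootMatrix, rootMatrix, Matrix.mul_add, Matrix.add_mul, Matrix.mul_one, hMM', mul_vecMulVec,
    vecMulVec_mul, hM, smul_vecMulVec, ← vecMulVec_smul, conjVec, snoc_zero_smul,
    snoc_init_of_last_eq_zero hlast]

/-- `g g⁻¹ = 1` at the level of matrices. [folklore] -/
private theorem coe_mul_coe_inv {k : ℕ} (g : SpecialLinearGroup (Fin k) F) :
    (g : Matrix (Fin k) (Fin k) F) * ((g⁻¹ : SpecialLinearGroup (Fin k) F) : Matrix (Fin k) (Fin k) F) = 1 := by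
  rw [← Matrix.SpecialLinearGroup.coe_mul, mul_inv_cancel, Matrix.SpecialLinearGroup.coe_one]

/-- `g⁻¹ g = 1` at the level of matrices. [folklore] -/
private theorem coe_inv_mul_coe {k : ℕ} (g : SpecialLinearGroup (Fin k) F) :
    ((g⁻¹ : SpecialLinearGroup (Fin k) F) : Matrix (Fin k) (Fin k) F) * (g : Matrix (Fin k) (Fin k) F) = 1 := by
  rw [← Matrix.SpecialLinearGroup.coe_mul, inv_mul_cancel, Matrix.SpecialLinearGroup.coe_one]

/-- `SL`-version of the conjugation formula. [cite: LandazuriSeitz1974, Lemma 3.1] -/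
theorem conj_rootHom {g : SpecialLinearGroup (Fin (m + 1)) F} {a : F}
    (hg : (g : Matrix (Fin (m + 1)) (Fin (m + 1)) F) *ᵥ lastVec m F = a • lastVec m F)
    (u : Fin m → F) :
    g * rootHom (Multiplicative.ofAdd u) * g⁻¹ =
      rootHom (Multiplicative.ofAdd (conjVec
        ((g⁻¹ : SpecialLinearGroup (Fin (m + 1)) F) : Matrix (Fin (m + 1)) (Fin (m + 1)) F) a u)) := by
  apply Subtype.ext
  change (g : Matrix (Fin (m + 1)) (Fin (m + 1)) F) * rootMatrix u *
      ((g⁻¹ : SpecialLinearGroup (Fin (m + 1)) F) : Matrix (Fin (m + 1)) (Fin (m + 1)) F) = rootMatrix _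
  exact conj_rootMatrix (coe_mul_coe_inv g) (coe_inv_mul_coe g) hg u

/-- Every `g ∈ SL_{m+1}(F)` with `g e = a e` normalises the root group `Q`.
[cite: LandazuriSeitz1974, Lemma 3.1 (proof: "`Q` normal in `P`")] -/
theorem mem_normalizer_of_mulVec_eq {g : SpecialLinearGroup (Fin (m + 1)) F} {a : F}
    (hg : (g : Matrix (Fin (m + 1)) (Fin (m + 1)) F) *ᵥ lastVec m F = a • lastVec m F) :
    g ∈ Subgroup.normalizer (rootSubgroup F m) := by
  obtain ⟨ha, hg'⟩ := inv_mulVec_lastVec (coe_inv_mul_coe g) hg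
  rw [Subgroup.mem_normalizer_iff]
  intro h
  constructor
  · rintro hh
    obtain ⟨u, rfl⟩ := mem_rootSubgroup_iff.mp hh
    rw [conj_rootHom hg]
    exact rootHom_mem _
  · intro hh
    obtain ⟨u, hu⟩ := mem_rootSubgroup_iff.mp hh
    have key : g⁻¹ * rootHom (Multiplicative.ofAdd u) * g⁻¹⁻¹ ∈ rootSubgroup F m := by
      rw [conj_rootHom hg']
      exact rootHom_mem _
    rw [hu, inv_inv] at key
    convert key using 1
    group

/-- The action on character parameters: conjugation by `g` (with `g e = a e`) takes the
character `x(u) ↦ ψ(u · y)` of `Q` to `x(u) ↦ ψ(u · y')` with `y' = a · init(g⁻¹ (y, 0))`.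
[cite: LandazuriSeitz1974, Lemma 3.1 (proof: action of `RH₀` on the characters of `Q`)] -/
def actVec (M' : Matrix (Fin (m + 1)) (Fin (m + 1)) F) (a : F) (y : Fin m → F) : Fin m → F :=
  a • Fin.init (M' *ᵥ Fin.snoc y 0)

/-- `c_g(u) · y = u · (a · init(g⁻¹ (y,0)))`. [cite: LandazuriSeitz1974, Lemma 3.1] -/
theorem conjVec_dotProduct (M' : Matrix (Fin (m + 1)) (Fin (m + 1)) F) (a : F) (u y : Fin m → F) :
    conjVec M' a u ⬝ᵥ y = u ⬝ᵥ actVec M' a y := by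
  rw [conjVec, actVec, smul_dotProduct, dotProduct_smul, ← dotProduct_snoc_zero, ← dotProduct_mulVec,
    snoc_zero_dotProduct]

end Conjugation

/-! ## §3 The characters of `Q ≅ F^m`: `u ↦ ψ(u · y)` -/

section Characters

/-- The additive character `u ↦ ψ(u · y)` of `F^m` attached to `y ∈ F^m` and an additive character
`ψ` of `F`. [folklore] -/
def dotChar (ψ : AddChar F ℂ) (y : Fin m → F) : AddChar (Fin m → F) ℂ :=
  ψ.compAddMonoidHom
    { toFun := fun u => u ⬝ᵥ y
      map_zero' := zero_dotProduct y
      map_add' := fun u u' => add_dotProduct u u' y }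

/-- Unfolding `dotChar`. [folklore] -/
private theorem dotChar_apply (ψ : AddChar F ℂ) (y u : Fin m → F) : dotChar ψ y u = ψ (u ⬝ᵥ y) := rfl

/-- For a non-trivial `ψ`, `y ↦ (u ↦ ψ(u · y))` is injective. [folklore] -/
private theorem dotChar_injective {ψ : AddChar F ℂ} (hψ : ψ 1 ≠ 1) :
    Function.Injective (dotChar (m := m) ψ) := by
  intro y y' h
  by_contra hne
  obtain ⟨j, hj⟩ : ∃ j, (y - y') j ≠ 0 := by
    by_contra h0
    push Not at h0
    exact hne (sub_eq_zero.mp (funext h0))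
  apply hψ
  -- `u = ((y - y') j)⁻¹ e_j` has `u · y = u · y' + 1`
  have hu : ∀ u : Fin m → F, ψ (u ⬝ᵥ y) = ψ (u ⬝ᵥ y') := fun u => by
    rw [← dotChar_apply, ← dotChar_apply, h]
  set x : F := Pi.single j ((y - y') j)⁻¹ ⬝ᵥ y' with hx
  have hxy : Pi.single j ((y - y') j)⁻¹ ⬝ᵥ y = x + 1 := by
    rw [hx, single_dotProduct, single_dotProduct, ← inv_mul_cancel₀ hj, Pi.sub_apply, mul_sub]
    ring
  have key := hu (Pi.single j ((y - y') j)⁻¹)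
  rw [hxy] at key
  -- `ψ 1 = ψ(x + 1) ψ(-x) = ψ(x) ψ(-x) = 1`
  have hxx : ψ x * ψ (-x) = 1 := by
    rw [← AddChar.map_add_eq_mul, add_neg_cancel, AddChar.map_zero_eq_one]
  calc ψ 1 = ψ (x + 1 + -x) := by rw [add_neg_cancel_comm]
    _ = ψ (x + 1) * ψ (-x) := AddChar.map_add_eq_mul ψ _ _
    _ = ψ x * ψ (-x) := by rw [key]
    _ = 1 := hxx

/-- **Every additive character of `F^m` is `u ↦ ψ(u · y)` for a unique `y`** (finite Fourier duality:
there are `|F^m|` characters, Mathlib `AddChar.card_eq`). [folklore] -/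
private theorem dotChar_bijective [Fintype F] {ψ : AddChar F ℂ} (hψ : ψ 1 ≠ 1) :
    Function.Bijective (dotChar (m := m) ψ) := by
  classical
  rw [Fintype.bijective_iff_injective_and_card]
  exact ⟨dotChar_injective hψ, (AddChar.card_eq (α := Fin m → F)).symm⟩

/-- Surjectivity of `y ↦ (u ↦ ψ(u · y))` onto the additive characters of `F^m`. [folklore] -/
private theorem exists_eq_dotChar [Fintype F] {ψ : AddChar F ℂ} (hψ : ψ 1 ≠ 1) (α : AddChar (Fin m → F) ℂ) :
    ∃ y : Fin m → F, dotChar ψ y = α :=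
  (dotChar_bijective hψ).2 α

/-- A finite field has a non-trivial additive character into `ℂ`. [folklore] -/
private theorem exists_addChar_one_ne_one [Fintype F] : ∃ ψ : AddChar F ℂ, ψ 1 ≠ 1 :=
  (AddChar.exists_apply_ne_zero (α := F)).mpr one_ne_zero

end Characters

/-! ## §4 Orbits: transitivity of `SL_m(F)` on non-zero vectors (`m ≥ 2`) and the block-diagonal
embedding `SL_m(F) → SL_{m+1}(F)` -/

section Orbits

/-- **`SL_{c+1}(F)` is transitive on non-zero vectors for `c ≥ 1`**: there is `S ∈ SL_{c+1}(F)`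
with `S e_last = y` (from the tree's `exists_lastRow_eq`: a matrix of `GL_{c+1}` with last row
`y`, transposed, with the first column rescaled to make the determinant `1`).
[cite: LandazuriSeitz1974, Lemma 3.1 (proof: "`RH₀` is transitive on `Q^#`")] -/
theorem exists_SL_mulVec_lastVec_eq {c : ℕ} (hc : 1 ≤ c) {y : Fin (c + 1) → F} (hy : y ≠ 0) :
    ∃ S : SpecialLinearGroup (Fin (c + 1)) F,
      (S : Matrix (Fin (c + 1)) (Fin (c + 1)) F) *ᵥ lastVec c F = y := by
  classical
  obtain ⟨γ, hγ⟩ := exists_lastRow_eq (F := F) hy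
  have h0 : (0 : Fin (c + 1)) ≠ Fin.last c := by
    intro h
    have := congrArg Fin.val h
    simp at this
    omega
  set d : F := (γ : Matrix (Fin (c + 1)) (Fin (c + 1)) F).det with hd
  have hdne : d ≠ 0 := by
    rw [hd]
    exact (Matrix.GeneralLinearGroup.det_ne_zero γ)
  set D : Matrix (Fin (c + 1)) (Fin (c + 1)) F := diagonal (Function.update 1 0 d⁻¹) with hD
  set S : Matrix (Fin (c + 1)) (Fin (c + 1)) F := (γ : Matrix (Fin (c + 1)) (Fin (c + 1)) F)ᵀ * D
    with hS
  have hdetD : D.det = d⁻¹ := by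
    rw [hD, det_diagonal, Fintype.prod_eq_single (0 : Fin (c + 1))]
    · simp
    · intro j hj
      simp [Function.update_of_ne hj]
  have hdetS : S.det = 1 := by
    rw [hS, det_mul, det_transpose, hdetD, ← hd, mul_inv_cancel₀ hdne]
  refine ⟨⟨S, hdetS⟩, ?_⟩
  change S *ᵥ lastVec c F = y
  have hDe : D *ᵥ lastVec c F = lastVec c F := by
    rw [hD, lastVec, diagonal_mulVec_single, Function.update_of_ne h0.symm]
    simp
  rw [hS, ← mulVec_mulVec, hDe, lastVec, mulVec_single_one]
  funext i
  have := congrFun hγ i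
  rw [lastRow_apply] at this
  simpa [Matrix.col_apply, Matrix.transpose_apply] using this

/-- **Transitivity of `SL_{c+1}(F)` (`c ≥ 1`) on non-zero vectors**: `B y = z`.
[cite: LandazuriSeitz1974, Lemma 3.1 (proof: "`RH₀` is transitive on `Q^#`")] -/
theorem exists_mulVec_eq {c : ℕ} (hc : 1 ≤ c) {y z : Fin (c + 1) → F} (hy : y ≠ 0) (hz : z ≠ 0) :
    ∃ B : SpecialLinearGroup (Fin (c + 1)) F, (B : Matrix (Fin (c + 1)) (Fin (c + 1)) F) *ᵥ y = z := by
  obtain ⟨Sy, hSy⟩ := exists_SL_mulVec_lastVec_eq hc hy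
  obtain ⟨Sz, hSz⟩ := exists_SL_mulVec_lastVec_eq hc hz
  refine ⟨Sz * Sy⁻¹, ?_⟩
  have hinv : ((Sy⁻¹ : SpecialLinearGroup (Fin (c + 1)) F) : Matrix (Fin (c + 1)) (Fin (c + 1)) F) *ᵥ y =
      lastVec c F := by
    rw [← hSy, mulVec_mulVec, coe_inv_mul_coe, one_mulVec]
  rw [Matrix.SpecialLinearGroup.coe_mul, ← mulVec_mulVec, hinv, hSz]

/-- The block-diagonal matrix `diag(B, 1)` on `F^{m+1} = F^m ⊕ F e`. [folklore] -/
def blockDiagMat (B : Matrix (Fin m) (Fin m) F) : Matrix (Fin (m + 1)) (Fin (m + 1)) F :=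
  Matrix.reindex finSumFinEquiv finSumFinEquiv (Matrix.fromBlocks B 0 0 (1 : Matrix (Fin 1) (Fin 1) F))

/-- `det diag(B, 1) = det B`. [folklore] -/
private theorem det_blockDiagMat (B : Matrix (Fin m) (Fin m) F) : (blockDiagMat B).det = B.det := by
  rw [blockDiagMat, det_reindex_self, det_fromBlocks_zero₂₁, det_one, mul_one]

/-- `diag(B B', 1) = diag(B, 1) diag(B', 1)`. [folklore] -/
private theorem blockDiagMat_mul (B B' : Matrix (Fin m) (Fin m) F) :
    blockDiagMat (B * B') = blockDiagMat B * blockDiagMat B' := by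
  simp only [blockDiagMat, reindex_apply, submatrix_mul_equiv, fromBlocks_multiply, Matrix.mul_zero,
    Matrix.zero_mul, add_zero, zero_add, Matrix.mul_one]

/-- `diag(1, 1) = 1`. [folklore] -/
private theorem blockDiagMat_one : blockDiagMat (1 : Matrix (Fin m) (Fin m) F) = 1 := by
  rw [blockDiagMat, fromBlocks_one, reindex_apply, submatrix_one_equiv]

/-- Entries of `diag(B, 1)`: upper-left block. [folklore] -/
private theorem blockDiagMat_apply_castSucc_castSucc (B : Matrix (Fin m) (Fin m) F) (i j : Fin m) :
    blockDiagMat B (Fin.castSucc i) (Fin.castSucc j) = B i j := by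
  rw [blockDiagMat, reindex_apply, submatrix_apply, finSumFinEquiv_symm_apply_castSucc,
    finSumFinEquiv_symm_apply_castSucc, fromBlocks_apply₁₁]

/-- Entries of `diag(B, 1)`: last column. [folklore] -/
private theorem blockDiagMat_apply_castSucc_last (B : Matrix (Fin m) (Fin m) F) (i : Fin m) :
    blockDiagMat B (Fin.castSucc i) (Fin.last m) = 0 := by
  rw [blockDiagMat, reindex_apply, submatrix_apply, finSumFinEquiv_symm_apply_castSucc,
    finSumFinEquiv_symm_last, fromBlocks_apply₁₂, Matrix.zero_apply]

/-- Entries of `diag(B, 1)`: last row. [folklore] -/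
private theorem blockDiagMat_apply_last_castSucc (B : Matrix (Fin m) (Fin m) F) (j : Fin m) :
    blockDiagMat B (Fin.last m) (Fin.castSucc j) = 0 := by
  rw [blockDiagMat, reindex_apply, submatrix_apply, finSumFinEquiv_symm_apply_castSucc,
    finSumFinEquiv_symm_last, fromBlocks_apply₂₁, Matrix.zero_apply]

/-- Entries of `diag(B, 1)`: corner. [folklore] -/
private theorem blockDiagMat_apply_last_last (B : Matrix (Fin m) (Fin m) F) :
    blockDiagMat B (Fin.last m) (Fin.last m) = 1 := by
  rw [blockDiagMat, reindex_apply, submatrix_apply, finSumFinEquiv_symm_last, fromBlocks_apply₂₂,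
    Matrix.one_apply_eq]

/-- `diag(B, 1) (y, c) = (B y, c)`. [folklore] -/
private theorem blockDiagMat_mulVec_snoc (B : Matrix (Fin m) (Fin m) F) (y : Fin m → F) (c : F) :
    blockDiagMat B *ᵥ Fin.snoc y c = Fin.snoc (B *ᵥ y) c := by
  funext i
  refine Fin.lastCases ?_ (fun i' => ?_) i
  · simp only [mulVec, dotProduct, Fin.sum_univ_castSucc, Fin.snoc_castSucc, Fin.snoc_last,
      blockDiagMat_apply_last_castSucc, blockDiagMat_apply_last_last, zero_mul,
      Finset.sum_const_zero, zero_add, one_mul]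
  · simp only [mulVec, dotProduct, Fin.sum_univ_castSucc, Fin.snoc_castSucc, Fin.snoc_last,
      blockDiagMat_apply_castSucc_castSucc, blockDiagMat_apply_castSucc_last, zero_mul, add_zero]

/-- **The block-diagonal embedding `R = SL_m(F) → SL_{m+1}(F)`**, `B ↦ diag(B, 1)`.
[cite: LandazuriSeitz1974, Lemma 3.1 (proof: "`P` contains a subgroup … `R ≅ SL(n − 1, q)`")] -/
def blockDiag : SpecialLinearGroup (Fin m) F →* SpecialLinearGroup (Fin (m + 1)) F where
  toFun B := ⟨blockDiagMat B, by rw [det_blockDiagMat, B.prop]⟩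
  map_one' := Subtype.ext (blockDiagMat_one (F := F) (m := m))
  map_mul' B B' := Subtype.ext (blockDiagMat_mul _ _)

/-- The matrix of `blockDiag B` is `diag(B, 1)`. [folklore] -/
private theorem coe_blockDiag (B : SpecialLinearGroup (Fin m) F) :
    ((blockDiag B : SpecialLinearGroup (Fin (m + 1)) F) : Matrix (Fin (m + 1)) (Fin (m + 1)) F) =
      blockDiagMat B := rfl

/-- `e = (0, 1)`. [folklore] -/
private theorem lastVec_eq_snoc : lastVec m F = Fin.snoc (0 : Fin m → F) 1 := by
  funext i
  refine Fin.lastCases ?_ (fun j => ?_) i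
  · rw [Fin.snoc_last, lastVec_apply_last]
  · rw [Fin.snoc_castSucc, lastVec, Pi.single_apply, if_neg (Fin.castSucc_lt_last j).ne]
    rfl

/-- `diag(B, 1) e = e`. [folklore] -/
private theorem blockDiag_mulVec_lastVec (B : SpecialLinearGroup (Fin m) F) :
    ((blockDiag B : SpecialLinearGroup (Fin (m + 1)) F) : Matrix (Fin (m + 1)) (Fin (m + 1)) F) *ᵥ
      lastVec m F = (1 : F) • lastVec m F := by
  rw [one_smul, coe_blockDiag, lastVec_eq_snoc, blockDiagMat_mulVec_snoc, mulVec_zero]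

/-- **Orbit for `m ≥ 2`**: for non-zero `y, z ∈ F^m` there is `g ∈ SL_{m+1}(F)` with `g e = e`
whose action on character parameters sends `y` to `z` ("`RH₀` is transitive on `Q^#` and hence
transitive on the nontrivial irreducible representations of `Q₀`").
[cite: LandazuriSeitz1974, Lemma 3.1] -/
theorem exists_actVec_eq (hm : 2 ≤ m) {y z : Fin m → F} (hy : y ≠ 0) (hz : z ≠ 0) :
    ∃ g : SpecialLinearGroup (Fin (m + 1)) F,
      (g : Matrix (Fin (m + 1)) (Fin (m + 1)) F) *ᵥ lastVec m F = (1 : F) • lastVec m F ∧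
      actVec (↑(g⁻¹) : Matrix (Fin (m + 1)) (Fin (m + 1)) F) 1 y = z := by
  obtain ⟨c, rfl⟩ : ∃ c, m = c + 1 := ⟨m - 1, by omega⟩
  obtain ⟨B, hB⟩ := exists_mulVec_eq (F := F) (by omega) hy hz
  refine ⟨blockDiag B⁻¹, blockDiag_mulVec_lastVec _, ?_⟩
  rw [← map_inv, inv_inv, actVec, one_smul, coe_blockDiag, blockDiagMat_mulVec_snoc, Fin.init_snoc, hB]

/-- The torus element `diag(a⁻¹, a) ∈ SL_2(F)`.
[cite: LandazuriSeitz1974, Lemma 3.1 (proof, `n = 2`: "`P` is Frobenius of order `(1/d) q (q-1)`")] -/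
def torus2 (a : F) (ha : a ≠ 0) : SpecialLinearGroup (Fin 2) F :=
  ⟨!![a⁻¹, 0; 0, a], by rw [det_fin_two_of, inv_mul_cancel₀ ha, mul_zero, sub_zero]⟩

/-- The matrix of `torus2 a`. [folklore] -/
private theorem coe_torus2 (a : F) (ha : a ≠ 0) :
    ((torus2 a ha : SpecialLinearGroup (Fin 2) F) : Matrix (Fin 2) (Fin 2) F) = !![a⁻¹, 0; 0, a] := rfl

/-- The matrix of `(torus2 a)⁻¹` is `diag(a, a⁻¹)`. [folklore] -/
private theorem coe_torus2_inv (a : F) (ha : a ≠ 0) :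
    (((torus2 a ha)⁻¹ : SpecialLinearGroup (Fin 2) F) : Matrix (Fin 2) (Fin 2) F) = !![a, 0; 0, a⁻¹] := by
  rw [Matrix.SpecialLinearGroup.coe_inv, coe_torus2, adjugate_fin_two_of, neg_zero]

/-- **Orbit for `m = 1`**: `diag(a⁻¹, a)` fixes the line `F e` (`g e = a e`) and acts on character
parameters by `y ↦ a² y`. [cite: LandazuriSeitz1974, Lemma 3.1] -/
theorem torus2_actVec (a : F) (ha : a ≠ 0) (y : Fin 1 → F) :
    ((torus2 a ha : SpecialLinearGroup (Fin 2) F) : Matrix (Fin 2) (Fin 2) F) *ᵥ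
        lastVec 1 F = a • lastVec 1 F ∧
      actVec (((torus2 a ha)⁻¹ : SpecialLinearGroup (Fin 2) F) : Matrix (Fin 2) (Fin 2) F) a y =
        (a ^ 2) • y := by
  have he : lastVec 1 F = ![0, 1] := by
    funext i
    fin_cases i
    · simp [lastVec]
    · rfl
  have hy : (Fin.snoc y (0 : F) : Fin 2 → F) = ![y 0, 0] := by
    funext i
    fin_cases i
    · exact Fin.snoc_castSucc (α := fun _ => F) (p := y) (x := 0) 0
    · exact Fin.snoc_last (α := fun _ => F) (p := y) (x := 0)
  constructor
  · rw [coe_torus2, he]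
    funext i
    fin_cases i <;> simp [mulVec, dotProduct, Fin.sum_univ_two]
  · rw [coe_torus2_inv, actVec, hy]
    funext j
    have hj : j = 0 := Subsingleton.elim j 0
    subst hj
    simp [Fin.init]
    ring

/-- `#(F^×)² ≥ (q − 1)/(2, q − 1)`: precisely, `q − 1 ≤ gcd(2, q − 1) · #{a² : a ∈ F^×}` (the
squaring map on `F^×` is at most `2`-to-`1`, and injective in characteristic `2`).
[cite: LandazuriSeitz1974, Lemma 3.1 (proof, `n = 2`: "1 or 2 nontrivial orbits … of length `(1/d)(q-1)`")] -/
theorem card_sub_one_le_gcd_mul_card_squares [Fintype F] [DecidableEq F] :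
    Fintype.card F - 1 ≤ Nat.gcd 2 (Fintype.card F - 1) *
      ((Finset.univ.filter fun a : F => a ≠ 0).image fun a : F => a ^ 2).card := by
  classical
  set s : Finset F := Finset.univ.filter fun a : F => a ≠ 0 with hs
  have hscard : s.card = Fintype.card F - 1 := by
    rw [hs, Finset.filter_ne' Finset.univ (0 : F), Finset.card_erase_of_mem (Finset.mem_univ _),
      Finset.card_univ]
  have hg1 : 1 ≤ Nat.gcd 2 (Fintype.card F - 1) := Nat.pos_of_ne_zero (by simp)
  -- fibres of the squaring map have at most `gcd(2, q-1)` elements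
  have hfib : ∀ b ∈ s.image (fun a : F => a ^ 2),
      (s.filter fun x : F => x ^ 2 = b).card ≤ Nat.gcd 2 (Fintype.card F - 1) := by
    intro b hb
    obtain ⟨a, -, rfl⟩ := Finset.mem_image.mp hb
    have hsub : (s.filter fun x : F => x ^ 2 = a ^ 2) ⊆ {a, -a} := by
      intro x hx
      rw [Finset.mem_filter] at hx
      rcases sq_eq_sq_iff_eq_or_eq_neg.mp hx.2 with h | h
      · simp [h]
      · simp [h]
    refine (Finset.card_le_card hsub).trans ?_
    by_cases h2 : ringChar F = 2
    · -- characteristic `2`: `-a = a`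
      haveI := ringChar.of_eq h2
      have hna : -a = a := by rw [neg_eq_iff_add_eq_zero, CharTwo.add_self_eq_zero]
      rw [hna, Finset.pair_eq_singleton, Finset.card_singleton]
      exact hg1
    · -- odd characteristic: `q - 1` is even, so `gcd(2, q-1) = 2`
      have hodd : Fintype.card F % 2 = 1 := by
        have h := FiniteField.even_card_iff_char_two (F := F)
        rcases Nat.mod_two_eq_zero_or_one (Fintype.card F) with h0 | h1
        · exact absurd (h.mpr h0) h2
        · exact h1
      have hg : Nat.gcd 2 (Fintype.card F - 1) = 2 := by
        rw [Nat.gcd_eq_left_iff_dvd]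
        have hpos : 0 < Fintype.card F := Fintype.card_pos
        omega
      rw [hg]
      exact Finset.card_le_two
  calc Fintype.card F - 1 = s.card := hscard.symm
    _ ≤ _ := Finset.card_le_mul_card_image s _ hfib

end Orbits

/-! ## §5 Clifford theory on `Q ⊴ P = N(Q)` and the degree bound -/

section Degree

variable [Fintype F] [DecidableEq F]

/-- An endomorphism of a one-dimensional space is the scalar `trace f`. [folklore] -/
private theorem end_eq_trace_smul_id {V : Type} [AddCommGroup V] [Module ℂ V] (h : Module.finrank ℂ V = 1)
    (f : V →ₗ[ℂ] V) : f = LinearMap.trace ℂ V f • LinearMap.id := by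
  haveI : Module.Finite ℂ V := Module.finite_of_finrank_eq_succ h
  obtain ⟨v, hv, hspan⟩ := finrank_eq_one_iff'.mp h
  obtain ⟨c, hc⟩ := hspan (f v)
  have hf : f = c • LinearMap.id := by
    refine LinearMap.ext fun w => ?_
    obtain ⟨a, rfl⟩ := hspan w
    rw [map_smul, ← hc, LinearMap.smul_apply, LinearMap.id_apply, smul_comm]
  have htr : LinearMap.trace ℂ V f = c := by
    rw [hf, map_smul, LinearMap.trace_id, h, Nat.cast_one, smul_eq_mul, mul_one]
  rw [htr, hf]

/-- The abstract form of the argument: if every non-trivial character parameter `y ≠ 0` of `Q`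
has at least `N` images `z` under elements `g ∈ SL_{m+1}(F)` fixing the line `F e`, then every
irreducible character `χ` of `SL_{m+1}(F)` of degree `> 1` has `χ(1) ≥ N` — provided normal
subgroups of `SL_{m+1}(F)` are central or everything (`m + 1 ≥ 3`, or `|F| ≥ 4`).
[cite: LandazuriSeitz1974, Lemma 3.1 (proof)] -/
theorem le_apply_one_of_orbits (hSL : 3 ≤ Fintype.card (Fin (m + 1)) ∨ ∃ a : F, a ≠ 0 ∧ a ^ 2 ≠ 1)
    (hm : 1 ≤ m) (N : ℕ)
    (horb : ∀ y : Fin m → F, y ≠ 0 → ∃ Z : Finset (Fin m → F), N ≤ Z.card ∧ ∀ z ∈ Z,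
      ∃ (g : SpecialLinearGroup (Fin (m + 1)) F) (a : F),
        (g : Matrix (Fin (m + 1)) (Fin (m + 1)) F) *ᵥ lastVec m F = a • lastVec m F ∧
        actVec (↑(g⁻¹) : Matrix (Fin (m + 1)) (Fin (m + 1)) F) a y = z)
    {χ : SpecialLinearGroup (Fin (m + 1)) F → ℂ} (hχ : IsIrrChar _ χ) {d : ℕ} (hd : χ 1 = d)
    (h1 : 1 < d) : N ≤ d := by
  classical
  -- notation
  set V : Subgroup (SpecialLinearGroup (Fin (m + 1)) F) := rootSubgroup F m with hV
  set P : Subgroup (SpecialLinearGroup (Fin (m + 1)) F) := Subgroup.normalizer V with hP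
  set K : Subgroup P := V.subgroupOf P with hK
  haveI hKn : K.Normal := Subgroup.normal_in_normalizer
  obtain ⟨ψ, hψ⟩ := exists_addChar_one_ne_one (F := F)
  -- the embedding `u ↦ x(u)` into `K`
  have hVP : V ≤ P := Subgroup.le_normalizer
  let ιK : (Fin m → F) → K := fun u =>
    ⟨⟨rootHom (Multiplicative.ofAdd u), hVP (rootHom_mem _)⟩,
      Subgroup.mem_subgroupOf.mpr (rootHom_mem _)⟩
  have ιK_coe : ∀ u, ((ιK u : P) : SpecialLinearGroup (Fin (m + 1)) F) =
      rootHom (Multiplicative.ofAdd u) := fun u => rfl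
  have ιK_add : ∀ u u', ιK (u + u') = ιK u * ιK u' := fun u u' => by
    apply Subtype.ext; apply Subtype.ext
    change rootHom (Multiplicative.ofAdd (u + u')) = rootHom (Multiplicative.ofAdd u) * rootHom _
    rw [ofAdd_add, map_mul]
  have ιK_surj : ∀ k : K, ∃ u, ιK u = k := fun k => by
    obtain ⟨u, hu⟩ := mem_rootSubgroup_iff.mp (Subgroup.mem_subgroupOf.mp k.2)
    exact ⟨u, Subtype.ext (Subtype.ext hu)⟩
  -- `K` is abelian
  haveI : IsMulCommutative K := ⟨⟨fun k k' => by
    obtain ⟨u, rfl⟩ := ιK_surj k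
    obtain ⟨u', rfl⟩ := ιK_surj k'
    rw [← ιK_add, ← ιK_add, add_comm u u']⟩⟩
  -- Step 0: the representation affording `χ` and its kernel
  obtain ⟨W, _, _, _, ρ, hρ, hρχ⟩ := hχ
  haveI := hρ
  by_cases hker : V ≤ MonoidHom.ker ρ
  · -- `Q ⊆ ker χ`: then `ker χ = SL` and `χ` is trivial, contradicting `d > 1`
    exfalso
    obtain ⟨j⟩ : Nonempty (Fin m) := ⟨⟨0, hm⟩⟩
    have hu : (Pi.single j (1 : F) : Fin m → F) ≠ 0 := by
      intro h; have := congrFun h j; simp at this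
    have hnc : ¬ MonoidHom.ker ρ ≤ Subgroup.center (SpecialLinearGroup (Fin (m + 1)) F) := fun hle =>
      rootHom_not_mem_center hu (hle (hker (rootHom_mem _)))
    haveI : Nontrivial (Fin (m + 1)) := Fin.nontrivial_iff_two_le.mpr (by omega)
    have htop : MonoidHom.ker ρ = ⊤ :=
      (Literature.LinearAlgebra.Matrix.SLn.normal_le_center_or_eq_top hSL (MonoidHom.ker ρ)).resolve_left hnc
    have hconst : ∀ g : SpecialLinearGroup (Fin (m + 1)) F, χ g = χ 1 := fun g => by
      rw [← hρχ]
      exact (mem_ker_iff_character_eq ρ g).mp (htop ▸ Subgroup.mem_top g)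
    have hsum := IsIrrChar.sum_normSq_eq_card ⟨W, _, _, ‹_›, ρ, hρ, hρχ⟩
    simp only [hconst, hd, Finset.sum_const, Finset.card_univ, nsmul_eq_mul, Complex.norm_natCast] at hsum
    have hG : (Fintype.card (SpecialLinearGroup (Fin (m + 1)) F) : ℝ) ≠ 0 :=
      Nat.cast_ne_zero.mpr Fintype.card_ne_zero
    have : (d : ℝ) ^ 2 = 1 := by
      have := hsum
      field_simp at this
      nlinarith [this]
    have hd1 : (d : ℝ) = 1 := by nlinarith [this, show (0 : ℝ) ≤ d from Nat.cast_nonneg d]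
    exact (Nat.cast_eq_one.mp hd1 ▸ h1 : 1 < 1).false
  · -- `Q ⊄ ker χ`: some root element `x(u₀)` moves `χ`
    obtain ⟨v, hvV, hvker⟩ := Set.not_subset.mp hker
    obtain ⟨u₀, rfl⟩ := mem_rootSubgroup_iff.mp hvV
    have hχv : χ (rootHom (Multiplicative.ofAdd u₀)) ≠ χ 1 := by
      rw [← hρχ]
      exact fun h => hvker ((mem_ker_iff_character_eq ρ _).mpr h)
    have hχirr : IsIrrChar (SpecialLinearGroup (Fin (m + 1)) F) χ := ⟨W, _, _, ‹_›, ρ, hρ, hρχ⟩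
    -- restrict to `P`
    set χP : P → ℂ := fun p => χ p with hχP
    have hχPchar : IsCharacter P χP := hχirr.isCharacter.restrict P
    have hχPcf : IsClassFun χP := hχPchar.isClassFun
    -- some irreducible constituent `θ` of `χ_P` is moved by `x(u₀)`
    set k₀ : P := (ιK u₀ : P) with hk₀
    obtain ⟨θ, hθ, hθe, hθk⟩ : ∃ θ : P → ℂ, IsIrrChar P θ ∧ classInner χP θ ≠ 0 ∧ θ k₀ ≠ θ 1 := by
      by_contra hall
      push Not at hall
      apply hχv
      have hexp := hχPcf.eq_sum_classInner_smul
      have e1 : χ (rootHom (Multiplicative.ofAdd u₀)) = χP k₀ := rfl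
      have e2 : χ 1 = χP 1 := rfl
      rw [e1, e2, hexp]
      simp only [Finset.sum_apply, Pi.smul_apply, smul_eq_mul]
      refine Finset.sum_congr rfl fun φ hφ => ?_
      have hφirr : IsIrrChar P φ := (irrChars_finite_holds P).mem_toFinset.mp hφ
      by_cases h0 : classInner χP φ = 0
      · rw [h0, zero_mul, zero_mul]
      · rw [hall φ hφirr h0]
    -- restrict `θ` to `K`: `[θ_K, 1_K] = 0` (Cor. 6.7), pick a constituent `λ ≠ 1` of `θ_K`
    have hθKchar : IsCharacter K (fun k : K => θ k) := hθ.isCharacter.restrict K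
    have hθK1 : classInner (fun k : K => θ k) 1 = 0 := by
      by_contra hne
      apply hθk
      have hk₀K : k₀ ∈ K := Subgroup.mem_subgroupOf.mpr (rootHom_mem _)
      exact apply_coe_eq_apply_one_of_classInner_restrict_one_ne_zero hθ hne ⟨k₀, hk₀K⟩
    have hθK0 : (fun k : K => θ k) ≠ 0 := by
      intro h
      have h1 := congrFun h 1
      simp only [OneMemClass.coe_one, Pi.zero_apply] at h1
      obtain ⟨dθ, hdθmem, hdθ⟩ := hθ.exists_apply_one
      obtain ⟨Wθ, _, _, _, σ, hσ, hσd⟩ := hdθmem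
      haveI := hσ
      have hpos : 0 < dθ := hσd ▸ Module.finrank_pos_iff.mpr (Representation.IsIrreducible.nontrivial (ρ := σ))
      rw [hdθ] at h1
      exact hpos.ne' (Nat.cast_eq_zero.mp h1)
    obtain ⟨lam, hlam, hlame⟩ := IsCharacter.exists_isIrrChar_classInner_ne_zero hθKchar hθK0
    -- `λ` is a linear character `u ↦ ψ(u · y)` with `y ≠ 0`
    have hlam1 : lam 1 = 1 := by
      obtain ⟨Wl, _, _, _, σ, hσ, rfl⟩ := hlam
      haveI := hσ
      rw [Representation.char_one, Representation.IsIrreducible.finrank_eq_one_of_isMulCommutative σ,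
        Nat.cast_one]
    have hlam_mul : ∀ k k' : K, lam (k * k') = lam k * lam k' := by
      obtain ⟨Wl, _, _, _, σ, hσ, rfl⟩ := hlam
      haveI := hσ
      have h1 : Module.finrank ℂ Wl = 1 :=
        Representation.IsIrreducible.finrank_eq_one_of_isMulCommutative σ
      intro k k'
      have key : ∀ g, σ g = σ.character g • LinearMap.id := fun g =>
        end_eq_trace_smul_id h1 (σ g)
      obtain ⟨w, hw, -⟩ := finrank_eq_one_iff'.mp h1
      have := LinearMap.congr_fun (_root_.map_mul σ k k') w
      rw [Module.End.mul_apply, key (k * k'), key k, key k'] at this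
      simp only [LinearMap.smul_apply, LinearMap.id_apply, smul_smul] at this
      exact smul_left_injective ℂ hw this
    let α : AddChar (Fin m → F) ℂ :=
      { toFun := fun u => lam (ιK u)
        map_zero_eq_one' := by
          have : ιK 0 = 1 := by
            apply Subtype.ext; apply Subtype.ext
            change rootHom (Multiplicative.ofAdd (0 : Fin m → F)) = 1
            rw [ofAdd_zero, map_one]
          rw [this, hlam1]
        map_add_eq_mul' := fun u u' => by
          change lam (ιK (u + u')) = lam (ιK u) * lam (ιK u')
          rw [ιK_add, hlam_mul] }
    obtain ⟨y, hy⟩ := exists_eq_dotChar hψ α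
    have hlamy : ∀ u, lam (ιK u) = ψ (u ⬝ᵥ y) := fun u => by
      rw [← dotChar_apply, hy]; rfl
    have hy0 : y ≠ 0 := by
      rintro rfl
      apply hlame
      have hl1 : lam = 1 := by
        funext k
        obtain ⟨u, rfl⟩ := ιK_surj k
        rw [hlamy, dotProduct_zero, AddChar.map_zero_eq_one, Pi.one_apply]
      rw [hl1, hθK1]
    -- the orbit of `λ` under `P` contains the `|Z|` characters `u ↦ ψ(u · z)`, `z ∈ Z`
    obtain ⟨Z, hNZ, hZ⟩ := horb y hy0
    choose g a hga hgz using hZ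
    have hconj : ∀ (z) (hz : z ∈ Z) (u : Fin m → F),
        lam (MulAut.conjNormal (⟨g z hz, mem_normalizer_of_mulVec_eq (hga z hz)⟩ : P) (ιK u)) =
          ψ (u ⬝ᵥ z) := by
      intro z hz u
      have hel : MulAut.conjNormal (⟨g z hz, mem_normalizer_of_mulVec_eq (hga z hz)⟩ : P) (ιK u) =
          ιK (conjVec (↑((g z hz)⁻¹) : Matrix (Fin (m + 1)) (Fin (m + 1)) F) (a z hz) u) := by
        apply Subtype.ext; apply Subtype.ext
        rw [MulAut.conjNormal_apply]
        change (g z hz : SpecialLinearGroup (Fin (m + 1)) F) * rootHom (Multiplicative.ofAdd u) *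
            (g z hz)⁻¹ = rootHom _
        exact conj_rootHom (hga z hz) u
      rw [hel, hlamy, conjVec_dotProduct, hgz z hz]
    set orbit := Finset.univ.image (fun x : P => fun k : K => lam (MulAut.conjNormal x k)) with horbit
    have hZle : Z.card ≤ orbit.card := by
      let f : (Fin m → F) → (K → ℂ) := fun z =>
        if hz : z ∈ Z then fun k : K =>
          lam (MulAut.conjNormal (⟨g z hz, mem_normalizer_of_mulVec_eq (hga z hz)⟩ : P) k)
        else 0
      have hfmem : ∀ z ∈ Z, f z ∈ orbit := fun z hz => by
        rw [horbit, Finset.mem_image]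
        exact ⟨⟨g z hz, mem_normalizer_of_mulVec_eq (hga z hz)⟩, Finset.mem_univ _, by
          simp only [f, dif_pos hz]⟩
      refine Finset.card_le_card_of_injOn f hfmem ?_
      intro z hz z' hz' hzz'
      have hz1 : z ∈ Z := hz
      have hz1' : z' ∈ Z := hz'
      apply dotChar_injective (m := m) hψ
      ext u
      rw [dotChar_apply, dotChar_apply, ← hconj z hz1 u, ← hconj z' hz1' u]
      have := congrFun hzz' (ιK u)
      simp only [f, dif_pos hz1, dif_pos hz1'] at this
      exact this
    -- Clifford: `θ(1) = e · t · λ(1) = e · t ≥ t ≥ |Z| ≥ N`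
    obtain ⟨eK, heKpos, heK⟩ := exists_classInner_restrict_eq_natCast_pos hθ hlam hlame
    have hθ1 := apply_one_eq_mul_of_classInner_restrict_ne_zero hθ hlam hlame
    rw [heK, hlam1, mul_one, ← horbit] at hθ1
    -- `χ(1) ≥ θ(1)`
    obtain ⟨ξ, hξ, hsplit⟩ := hχPchar.exists_eq_add_of_classInner_ne_zero hθ hθe
    obtain ⟨nξ, hnξ⟩ := hξ.exists_nat_apply_one
    have hχ1 : (d : ℂ) = (eK * orbit.card : ℕ) + nξ := by
      rw [← hd, show χ 1 = χP 1 from rfl, hsplit, Pi.add_apply, hθ1, hnξ, Nat.cast_mul]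
    have hdn : d = eK * orbit.card + nξ := by exact_mod_cast hχ1
    calc N ≤ Z.card := hNZ
      _ ≤ orbit.card := hZle
      _ ≤ eK * orbit.card := Nat.le_mul_of_pos_left _ heKpos
      _ ≤ d := by omega

/-- **Landazuri–Seitz 1974, Lemma 3.1 (`n > 2`), for the complex characters of `SL_n(𝔽_q)`**:
every irreducible complex character of `SL_n(F)`, `n ≥ 3`, `F` a finite field with `q` elements,
of degree `d > 1` has `d ≥ q^{n−1} − 1`.  (`n = m + 1`.)
[cite: LandazuriSeitz1974, Lemma 3.1] -/
theorem le_charDegree_of_three_le (hm : 2 ≤ m) {d : ℕ}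
    (hd : d ∈ charDegrees (SpecialLinearGroup (Fin (m + 1)) F)) (h1 : 1 < d) :
    Fintype.card F ^ m - 1 ≤ d := by
  classical
  obtain ⟨χ, hχ, hχd⟩ := exists_isIrrChar_of_mem_charDegrees hd
  refine le_apply_one_of_orbits (Or.inl (by simp; omega)) (by omega) _ (fun y hy => ?_) hχ hχd h1
  refine ⟨Finset.univ.filter fun z : Fin m → F => z ≠ 0, ?_, fun z hz => ?_⟩
  · rw [Finset.filter_ne' Finset.univ (0 : Fin m → F), Finset.card_erase_of_mem (Finset.mem_univ _),
      Finset.card_univ, Fintype.card_fun, Fintype.card_fin]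
  · obtain ⟨g, hg, hgz⟩ := exists_actVec_eq hm hy (Finset.mem_filter.mp hz).2
    exact ⟨g, 1, hg, hgz⟩

/-- **Landazuri–Seitz 1974, Lemma 3.1 (`n = 2`), for the complex characters of `SL_2(𝔽_q)`**:
every irreducible complex character of `SL_2(F)` of degree `d > 1` has
`d ≥ (q − 1)/(2, q − 1)`, stated without division as `q − 1 ≤ gcd(2, q − 1) · d`.
[cite: LandazuriSeitz1974, Lemma 3.1] -/
theorem le_charDegree_two {d : ℕ} (hd : d ∈ charDegrees (SpecialLinearGroup (Fin 2) F))
    (h1 : 1 < d) : Fintype.card F - 1 ≤ Nat.gcd 2 (Fintype.card F - 1) * d := by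
  classical
  -- small fields: the bound is at most `1`
  by_cases hF : ∃ a : F, a ≠ 0 ∧ a ^ 2 ≠ 1
  swap
  · push Not at hF
    -- every non-zero element squares to `1`: `|F| ≤ 3`
    have hcard : Fintype.card F ≤ 3 := by
      have hsub : (Finset.univ : Finset F) ⊆ {0, 1, -1} := by
        intro a _
        by_cases ha : a = 0
        · simp [ha]
        · rcases sq_eq_one_iff.mp (hF a ha) with h | h <;> simp [h]
      calc Fintype.card F = (Finset.univ : Finset F).card := Finset.card_univ.symm
        _ ≤ ({0, 1, -1} : Finset F).card := Finset.card_le_card hsub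
        _ ≤ 3 := Finset.card_le_three
    have hg : 1 ≤ Nat.gcd 2 (Fintype.card F - 1) := Nat.pos_of_ne_zero (by simp)
    calc Fintype.card F - 1 ≤ 2 := by omega
      _ ≤ 1 * d := by omega
      _ ≤ Nat.gcd 2 (Fintype.card F - 1) * d := Nat.mul_le_mul_right d hg
  obtain ⟨χ, hχ, hχd⟩ := exists_isIrrChar_of_mem_charDegrees hd
  set S : Finset F := (Finset.univ.filter fun a : F => a ≠ 0).image fun a : F => a ^ 2 with hS
  have hmain : S.card ≤ d := by
    refine le_apply_one_of_orbits (m := 1) (Or.inr hF) le_rfl S.card (fun y hy => ?_) hχ hχd h1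
    have hy0 : y 0 ≠ 0 := by
      intro h; apply hy; funext i; rw [Subsingleton.elim i 0, h]; rfl
    have hinj : Function.Injective fun b : F => b • y := by
      intro b b' hbb'
      have := congrFun hbb' 0
      simp only [Pi.smul_apply, smul_eq_mul] at this
      exact mul_right_cancel₀ hy0 this
    refine ⟨S.image fun b : F => b • y, (Finset.card_image_of_injective S hinj).ge, fun z hz => ?_⟩
    obtain ⟨b, hb, rfl⟩ := Finset.mem_image.mp hz
    obtain ⟨a, ha, rfl⟩ := Finset.mem_image.mp hb
    have ha0 : a ≠ 0 := (Finset.mem_filter.mp ha).2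
    exact ⟨torus2 a ha0, a, (torus2_actVec a ha0 y).1, (torus2_actVec a ha0 y).2⟩
  calc Fintype.card F - 1 ≤ Nat.gcd 2 (Fintype.card F - 1) * S.card :=
        card_sub_one_le_gcd_mul_card_squares
    _ ≤ Nat.gcd 2 (Fintype.card F - 1) * d := Nat.mul_le_mul_left _ hmain

/-- The coarse form `q ≤ 2 d + 1` (i.e. `d ≥ (q − 1)/2`) valid for EVERY `n ≥ 2` and every
character degree `d > 1` of `SL_n(𝔽_q)` — the form consumed by the matrix-multiplication barrier
(`n(SL_n(q)) ≥ (q−1)/2`, and `≥ q^{n−1} − 1 ≥ (q − 1)/2` for `n ≥ 3`).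
[cite: LandazuriSeitz1974, Lemma 3.1] -/
theorem card_le_two_mul_charDegree_add_one (hm : 1 ≤ m) {d : ℕ}
    (hd : d ∈ charDegrees (SpecialLinearGroup (Fin (m + 1)) F)) (h1 : 1 < d) :
    Fintype.card F ≤ 2 * d + 1 := by
  have hq : 1 < Fintype.card F := Fintype.one_lt_card
  rcases Nat.lt_or_ge m 2 with hlt | hge
  · obtain rfl : m = 1 := by omega
    have h := le_charDegree_two hd h1
    have hg : Nat.gcd 2 (Fintype.card F - 1) ≤ 2 := Nat.gcd_le_left _ two_pos
    have := Nat.mul_le_mul_right d hg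
    omega
  · have h := le_charDegree_of_three_le hge hd h1
    have hpow : Fintype.card F ≤ Fintype.card F ^ m := by
      calc Fintype.card F = Fintype.card F ^ 1 := (pow_one _).symm
        _ ≤ Fintype.card F ^ m := Nat.pow_le_pow_right (by omega) (by omega)
    omega

end Degree

end SLn

end Literature.RepresentationTheory.FiniteGroups

end
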